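import Summits.Ventures.QEC.CircuitDistance.PortK2DataBB144Z
import Summits.Ventures.QEC.CircuitDistance.K2Chunks
import HarnessLib

/-!
# K2(`[[144,12,12]]`) chunk module — COMPUTATIONAL (native_decide; `Lean.ofReduceBool`)

Cell `qec`, CDX, R146/R152 STEP 1 («computational» header; `ofReduceBool` confined to these chunk modules). Checker of record
`K2.K2Data` (qec-cdx-type-1, PortK2Check); data module of record `PortK2DataBB144X/Z` (p669158/9, crit-1 data audit PASS
2026-08-28T21:20Z); chunk glue `K2Chunks` (idea-1 g2). Cube 0, child 13: leaf group 7 of 11.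
Leaf theorems: the K2 DFS accepts below one descendant state of pivot cube 0 (sector Z); sizes are exact DFS visit counts
(eng-1 g2 `k2count.c`), capped so that the gate's native-axiom audit re-verifies every leaf in place. Assemblies re-derive the
child lists in the kernel (`decide`) and end in the literal cube fact `d144Z.cube (Ts144Z.getD 0 []) (0) (lives144Z.getD 0 0) = true`
(the `hcubes` hypothesis of `K2Inst.k2_complete`). Emitted by qec-cdx-eng-1 g2 (`gen2.py`, idea-1's `gen_k2chunks_from_lean.py` lineage).
-/

namespace Summit.Ventures.QEC.CircuitDistance.K2

set_option maxRecDepth 100000 in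
set_option maxHeartbeats 0 in
set_option exponentiation.threshold 1024 in
/-- K2(144) chunk fact `cube144Z0_ch13_8` (757934 DFS visits; see the module docstring). -/
theorem cube144Z0_ch13_8 : app5 (d144Z.dfs (Ts144Z.getD 0 []) 6) (300912512702389179456, 1361, 431359146674410236738056267589608537469453268084109688012152684675073, 3, 2348542582773833227889480596789337027375244028525811998192735290054140724394934863282470975246418284564709340) = true := by native_decide

set_option maxRecDepth 100000 in
set_option maxHeartbeats 0 in
set_option exponentiation.threshold 1024 in
/-- K2(144) chunk fact `cube144Z0_ch13_9` (669816 DFS visits; see the module docstring). -/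
theorem cube144Z0_ch13_9 : app5 (d144Z.dfs (Ts144Z.getD 0 []) 6) (2362336162939448378624, 977, 431359146674410248687293654407070796702780460372439656719057156046849, 3, 2348542582773833227889480596789337027375244028525811998180762668641125967689010277132859184749396885172649948) = true := by native_decide
end Summit.Ventures.QEC.CircuitDistance.K2
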